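import Mathlib.NumberTheory.LSeries.Deriv
import Literature.Barriers.RiemannHypothesis.DavenportHeilbronnSeries
import Literature.NumberTheory.LFunctions.SaiasWeingartner
import Literature.NumberTheory.LFunctions.FiniteLSeries
import HarnessLib

/-!
# Twisted linear combinations of Dirichlet `L`-functions (Saias–Weingartner 2009, §4)

Topic `Literature/NumberTheory/LFunctions` (namespace `Literature.NumberTheory.LFunctions`).
Saias–Weingartner prove the case `σ₁ ≥ 1` of their Theorem 2 (`SaiasWeingartner2009_thm2_right`,
`SaiasWeingartner.lean`) by comparing `F(s + it) = ∑ⱼ Pⱼ(s + it) L(s + it, χⱼ)` with the functions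
`Gⱼ(s) = hⱼ(p₁^{-s-it_{p₁}}, …) ∏_{p > p_L} (1 − χⱼ(p) p^{-s-it_p})^{-1}` obtained by shifting every
prime by its own `t_p` (§4, p. 8 of arXiv:0807.0783). Only the phases `p^{-it_p}` matter, so we
TWIST by unit complex numbers `e(p)` attached to the primes: with `ẽ` the completely
multiplicative extension of `e` (`Literature.Barriers.RiemannHypothesis.complMul`, Titchmarsh
§10.25, reused from the Davenport–Heilbronn files),

  `F^e(s) := ∑ⱼ (∑ₖ Pⱼ(k) ẽ(k) k^{-s}) · (∑ₘ χⱼ(m) ẽ(m) m^{-s})` (`twistedComb χ P e s`,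
  `Re s > 1`),

and `F(s + it) = F^{e_t}(s)` for the shift twist `e_t(p) = p^{-it}` (`twistedComb_shiftPhase`).

Main results (all PROVED):
* `shiftPhase`, `complMul_shiftPhase`: `ẽ_t(n) = n^{-it}`;
* `twistedComb_shiftPhase`: `F^{e_t}(s) = F(s + it)` for `Re s > 1` (`F = charCombination χ P`);
* `differentiableOn_twistedComb`: `F^e` is holomorphic on `Re s > 1`;
* `norm_complMul_sub_complMul_le`: `|ẽ₁(n) − ẽ₂(n)| ≤ nη` for `n ≤ Q` if `|e₁(p) − e₂(p)| ≤ η`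
  for the primes `p ≤ Q` (complete multiplicativity, as in the tree's
  `Literature.Barriers.RiemannHypothesis.norm_cpow_sub_dhPsiMul_le`);
* `exists_forall_norm_twistedComb_sub_le`: **uniform comparison** — for `σ₀ > 1` and `ε > 0`
  there are `Q` and `η > 0` such that `|F^{e₁}(s) − F^{e₂}(s)| ≤ ε` for all `Re s ≥ σ₀` whenever
  `|e₁(p) − e₂(p)| < η` for the primes `p ≤ Q` (the two displayed estimates with `γ/3n` on p. 8
  of the source, done coefficientwise as in the tree's proof of the Davenport–Heilbronn barrier,
  `Literature.Barriers.RiemannHypothesis.exists_forall_norm_sub_dhN_le`).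

## References

* [SaiasWeingartner2009] E. Saias, A. Weingartner, *Zeros of Dirichlet series with periodic
  coefficients*, Acta Arith. 140 (2009), 335–344, §4 (read, arXiv:0807.0783 p. 8).
* [Titchmarsh1986] E. C. Titchmarsh, *The Theory of the Riemann Zeta-Function*, 2nd ed., §10.25
  (the twist `α(n)` and the comparison `f(s + iτ) ≈ N(s)`).
-/

noncomputable section

open Complex LSeries Finset
open Literature.Barriers.RiemannHypothesis (complMul complMul_prime complMul_prime_pow
  norm_complMul_le_one)

namespace Literature.NumberTheory.LFunctions

/-! ### The shift twist `e_t(p) = p^{-it}` -/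

/-- The shift twist `e_t(n) = n^{-it}` (used at the primes; it is already completely
multiplicative). [cite: SaiasWeingartner2009, §4] -/
def shiftPhase (t : ℝ) (n : ℕ) : ℂ := (n : ℂ) ^ (-(t : ℂ) * I)

/-- Unfolding `shiftPhase`. [folklore] -/
theorem shiftPhase_apply (t : ℝ) (n : ℕ) : shiftPhase t n = (n : ℂ) ^ (-(t : ℂ) * I) := rfl

/-- `|e_t(n)| = 1` for `n ≥ 1`. [folklore] -/
theorem norm_shiftPhase {n : ℕ} (hn : n ≠ 0) (t : ℝ) : ‖shiftPhase t n‖ = 1 := by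
  rw [shiftPhase_apply, show -(t : ℂ) * I = ((-t : ℝ) : ℂ) * I by push_cast; ring,
    norm_natCast_cpow_of_pos (Nat.pos_of_ne_zero hn)]
  simp

/-- `|e_t(p)| = 1` at every prime. [folklore] -/
theorem norm_shiftPhase_prime (t : ℝ) (p : ℕ) (hp : p.Prime) : ‖shiftPhase t p‖ = 1 :=
  norm_shiftPhase hp.ne_zero t

/-- The completely multiplicative extension of `p ↦ p^{-it}` is `n ↦ n^{-it}`. [folklore] -/
theorem complMul_shiftPhase {n : ℕ} (hn : n ≠ 0) (t : ℝ) :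
    complMul (shiftPhase t) n = (n : ℂ) ^ (-(t : ℂ) * I) := by
  induction n using Nat.recOnPosPrimePosCoprime with
  | prime_pow p k hp hk =>
    rw [complMul_prime_pow _ hp, shiftPhase_apply, Nat.cast_pow, ← cpow_nat_mul,
      natCast_cpow_natCast_mul]
  | zero => exact absurd rfl hn
  | one => simp
  | coprime a b ha hb hab iha ihb =>
    rw [map_mul, iha (by omega), ihb (by omega), Nat.cast_mul, natCast_mul_natCast_cpow]

/-! ### Twisted combinations -/

/-- **The twisted combination** `F^e(s) = ∑ⱼ (∑ₖ Pⱼ(k) ẽ(k) k^{-s}) (∑ₘ χⱼ(m) ẽ(m) m^{-s})`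
(`ẽ = complMul e`), the function `∑ⱼ Gⱼ(s)` of [SaiasWeingartner2009], §4 with `e(p) = p^{-it_p}`.
Meaningful for `Re s > 1`. [cite: SaiasWeingartner2009, §4] -/
def twistedComb {ι : Type*} [Fintype ι] {q : ι → ℕ} (χ : ∀ i, DirichletCharacter ℂ (q i))
    (P : ι → ℕ → ℂ) (e : ℕ → ℂ) (s : ℂ) : ℂ :=
  ∑ i, LSeries (fun n ↦ P i n * complMul e n) s * LSeries (fun n ↦ χ i n * complMul e n) s

/-- Unfolding `twistedComb`. [folklore] -/
theorem twistedComb_apply {ι : Type*} [Fintype ι] {q : ι → ℕ} (χ : ∀ i, DirichletCharacter ℂ (q i))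
    (P : ι → ℕ → ℂ) (e : ℕ → ℂ) (s : ℂ) :
    twistedComb χ P e s =
      ∑ i, LSeries (fun n ↦ P i n * complMul e n) s * LSeries (fun n ↦ χ i n * complMul e n) s :=
  rfl

section Basic

variable {ι : Type*} [Fintype ι] {q : ι → ℕ}

/-- The twisted Dirichlet polynomial has finite support. [folklore] -/
theorem support_mul_finite {P : ℕ → ℂ} (hP : (Function.support P).Finite) (u : ℕ → ℂ) :
    (Function.support fun n ↦ P n * u n).Finite :=
  hP.subset fun n hn ↦ by
    simp only [Function.mem_support, ne_eq, mul_eq_zero, not_or] at hn ⊢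
    exact hn.1

/-- The twisted character coefficients are bounded by `1` (unit phases at the primes).
[folklore] -/
theorem norm_char_mul_complMul_le_one {N : ℕ} (χ : DirichletCharacter ℂ N) {e : ℕ → ℂ}
    (he : ∀ p, p.Prime → ‖e p‖ ≤ 1) (n : ℕ) : ‖χ n * complMul e n‖ ≤ 1 := by
  rw [norm_mul]
  exact mul_le_one₀ (χ.norm_le_one n) (norm_nonneg _) (norm_complMul_le_one he n)

/-- The twisted `L`-series converges absolutely for `Re s > 1`. [folklore] -/
theorem LSeriesSummable_char_mul_complMul {N : ℕ} (χ : DirichletCharacter ℂ N) {e : ℕ → ℂ}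
    (he : ∀ p, p.Prime → ‖e p‖ ≤ 1) {s : ℂ} (hs : 1 < s.re) :
    LSeriesSummable (fun n ↦ χ n * complMul e n) s :=
  LSeriesSummable_of_bounded_of_one_lt_re (m := 1) (fun n _ ↦ norm_char_mul_complMul_le_one χ he n)
    hs

/-- The twisted `L`-series is holomorphic on `Re s > 1`. [folklore] -/
theorem differentiableOn_LSeries_char_mul_complMul {N : ℕ} (χ : DirichletCharacter ℂ N)
    {e : ℕ → ℂ} (he : ∀ p, p.Prime → ‖e p‖ ≤ 1) :
    DifferentiableOn ℂ (LSeries fun n ↦ χ n * complMul e n) {s : ℂ | 1 < s.re} := by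
  intro s hs
  have h : abscissaOfAbsConv (fun n ↦ χ n * complMul e n) < s.re :=
    (abscissaOfAbsConv_le_of_forall_lt_LSeriesSummable fun y hy ↦
      LSeriesSummable_char_mul_complMul χ he (by simpa using hy)).trans_lt (by exact_mod_cast hs)
  exact ((LSeries_analyticOnNhd _ s h).differentiableAt).differentiableWithinAt

/-- **`F^e` is holomorphic on `Re s > 1`.** [folklore] -/
theorem differentiableOn_twistedComb (χ : ∀ i, DirichletCharacter ℂ (q i)) {P : ι → ℕ → ℂ}
    (hP : ∀ i, (Function.support (P i)).Finite) {e : ℕ → ℂ} (he : ∀ p, p.Prime → ‖e p‖ ≤ 1) :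
    DifferentiableOn ℂ (twistedComb χ P e) {s : ℂ | 1 < s.re} := by
  change DifferentiableOn ℂ (fun s ↦ ∑ i, LSeries (fun n ↦ P i n * complMul e n) s *
      LSeries (fun n ↦ χ i n * complMul e n) s) {s : ℂ | 1 < s.re}
  refine DifferentiableOn.fun_sum fun i _ ↦ DifferentiableOn.mul ?_ ?_
  · exact (FiniteLSeries.differentiable (support_mul_finite (hP i) _)).differentiableOn
  · exact differentiableOn_LSeries_char_mul_complMul (χ i) he

/-- **The shift twist is a vertical shift**: for `Re s > 1`, `F^{e_t}(s) = F(s + it)`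
(`F = charCombination χ P`, whose `L`-functions agree with their series for `Re > 1`).
[cite: SaiasWeingartner2009, §4] -/
theorem twistedComb_shiftPhase [∀ i, NeZero (q i)] (χ : ∀ i, DirichletCharacter ℂ (q i))
    (P : ι → ℕ → ℂ) (t : ℝ) {s : ℂ} (hs : 1 < s.re) :
    twistedComb χ P (shiftPhase t) s = charCombination χ P (s + t * I) := by
  rw [twistedComb_apply, charCombination_apply]
  have hs' : 1 < (s + t * I).re := by simpa using hs
  have key : ∀ (a : ℕ → ℂ), LSeries (fun n ↦ a n * complMul (shiftPhase t) n) s =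
      LSeries a (s + t * I) := by
    intro a
    refine tsum_congr fun n ↦ ?_
    rcases eq_or_ne n 0 with rfl | hn
    · simp
    rw [term_of_ne_zero hn, term_of_ne_zero hn, complMul_shiftPhase hn, cpow_add _ _
      (Nat.cast_ne_zero.2 hn), show -(t : ℂ) * I = -((t : ℂ) * I) by ring, cpow_neg]
    field_simp
  refine Finset.sum_congr rfl fun i _ ↦ ?_
  rw [key, key, DirichletCharacter.LFunction_eq_LSeries _ hs']

end Basic

/-! ### Complete multiplicativity of the twist error -/

/-- **Two twists close at the primes `p ≤ Q` are close at all `n ≤ Q`**: if `|e₁(p)|, |e₂(p)| ≤ 1`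
at the primes and `|e₁(p) − e₂(p)| ≤ η` for the primes `p ≤ Q`, then `|ẽ₁(n) − ẽ₂(n)| ≤ nη` for
`1 ≤ n ≤ Q`. [folklore] -/
theorem norm_complMul_sub_complMul_le {e₁ e₂ : ℕ → ℂ} (he₁ : ∀ p, p.Prime → ‖e₁ p‖ ≤ 1)
    (he₂ : ∀ p, p.Prime → ‖e₂ p‖ ≤ 1) {η : ℝ} (hη : 0 ≤ η) {Q : ℕ}
    (h : ∀ p : ℕ, p.Prime → p ≤ Q → ‖e₁ p - e₂ p‖ ≤ η) :
    ∀ n : ℕ, n ≠ 0 → n ≤ Q → ‖complMul e₁ n - complMul e₂ n‖ ≤ n * η := by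
  intro n
  induction n using Nat.strong_induction_on with
  | _ n ih =>
    intro hn hnQ
    rcases Nat.lt_or_ge n 2 with hlt | hge
    · obtain rfl : n = 1 := by omega
      simpa using hη
    set p := n.minFac with hp
    have hpp : p.Prime := Nat.minFac_prime (by omega)
    obtain ⟨m, hm⟩ := (Nat.minFac_dvd n : p ∣ n)
    have hm0 : m ≠ 0 := by rintro rfl; simp at hm; exact hn hm
    have hp2 : 2 ≤ p := hpp.two_le
    have hmn : m < n := by
      rcases Nat.eq_or_lt_of_le (Nat.one_le_iff_ne_zero.2 hm0) with h1 | h1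
      · rw [hm, ← h1]; omega
      · calc m < 2 * m := by omega
          _ ≤ p * m := Nat.mul_le_mul_right m hp2
          _ = n := hm.symm
    have hpQ : p ≤ Q := (Nat.minFac_le (by omega)).trans hnQ
    have ihm := ih m hmn hm0 (hmn.le.trans hnQ)
    have hψ := h p hpp hpQ
    have hsplit : complMul e₁ n - complMul e₂ n =
        (e₁ p - e₂ p) * complMul e₁ m + e₂ p * (complMul e₁ m - complMul e₂ m) := by
      rw [hm, map_mul, map_mul, complMul_prime _ hpp, complMul_prime _ hpp]
      ring
    rw [hsplit]
    refine (norm_add_le _ _).trans ?_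
    rw [norm_mul, norm_mul]
    have hcast : ((p * m : ℕ) : ℝ) = p * m := by push_cast; ring
    rw [hm, hcast]
    have hpm : (1 : ℝ) + m ≤ p * m := by
      have h1 : 1 + m ≤ p * m :=
        calc 1 + m ≤ m + m := by omega
          _ = 2 * m := by ring
          _ ≤ p * m := Nat.mul_le_mul_right m hp2
      exact_mod_cast h1
    calc ‖e₁ p - e₂ p‖ * ‖complMul e₁ m‖ + ‖e₂ p‖ * ‖complMul e₁ m - complMul e₂ m‖
        ≤ η * 1 + 1 * (m * η) :=
          add_le_add (mul_le_mul hψ (norm_complMul_le_one he₁ m) (norm_nonneg _) hη)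
            (mul_le_mul (he₂ p hpp) ihm (norm_nonneg _) zero_le_one)
      _ = (1 + m) * η := by ring
      _ ≤ p * m * η := mul_le_mul_of_nonneg_right hpm hη

/-! ### Uniform comparison of two twists -/

/-- **Twisted Dirichlet polynomials**: for `Re s ≥ 0`,
`|∑ₖ P(k)u₁(k)k^{-s} − ∑ₖ P(k)u₂(k)k^{-s}| ≤ ∑_{k ≥ 1} |P k| · |u₁ k − u₂ k|`. [folklore] -/
theorem FiniteLSeries.norm_twist_sub_le {P : ℕ → ℂ} (hP : (Function.support P).Finite) {s : ℂ}
    (hs : 0 ≤ s.re) (u₁ u₂ : ℕ → ℂ) :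
    ‖LSeries (fun n ↦ P n * u₁ n) s - LSeries (fun n ↦ P n * u₂ n) s‖ ≤
      ∑ n ∈ hP.toFinset with n ≠ 0, ‖P n‖ * ‖u₁ n - u₂ n‖ := by
  have h₁ := support_mul_finite hP u₁
  have h₂ := support_mul_finite hP u₂
  have e₁ : LSeries (fun n ↦ P n * u₁ n) s = ∑ n ∈ hP.toFinset, term (fun n ↦ P n * u₁ n) s n :=
    tsum_eq_sum fun n hn ↦ by
      have : P n = 0 := by simpa using hn
      rcases eq_or_ne n 0 with rfl | hn0
      · simp
      · simp [term_of_ne_zero hn0, this]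
  have e₂ : LSeries (fun n ↦ P n * u₂ n) s = ∑ n ∈ hP.toFinset, term (fun n ↦ P n * u₂ n) s n :=
    tsum_eq_sum fun n hn ↦ by
      have : P n = 0 := by simpa using hn
      rcases eq_or_ne n 0 with rfl | hn0
      · simp
      · simp [term_of_ne_zero hn0, this]
  rw [e₁, e₂, ← sum_sub_distrib]
  have h0 : ∀ n ∈ hP.toFinset,
      term (fun n ↦ P n * u₁ n) s n - term (fun n ↦ P n * u₂ n) s n ≠ 0 → n ≠ 0 := by
    rintro n - h rfl
    exact h (by simp)
  rw [← sum_filter_of_ne h0]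
  refine (norm_sum_le _ _).trans (sum_le_sum fun n hn ↦ ?_)
  obtain ⟨-, hn0⟩ := mem_filter.1 hn
  have hn' : (n : ℂ) ≠ 0 := Nat.cast_ne_zero.2 hn0
  rw [term_of_ne_zero hn0, term_of_ne_zero hn0, ← sub_div, ← mul_sub, norm_div, norm_mul,
    norm_natCast_cpow_of_pos (Nat.pos_of_ne_zero hn0)]
  refine div_le_self (by positivity) ?_
  exact Real.one_le_rpow (by exact_mod_cast Nat.one_le_iff_ne_zero.2 hn0) hs

/-- **Bounded coefficients close for `n ≤ Q`**: if `|b₁|, |b₂| ≤ 1`, then for `σ₀ > 1` and `ε > 0`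
there are `Q`, `η > 0` with `|∑ b₁(n)n^{-s} − ∑ b₂(n)n^{-s}| ≤ ε` for `Re s ≥ σ₀` as soon as
`|b₁(n) − b₂(n)| ≤ nη` for `1 ≤ n ≤ Q` (head `≤ Qη ζ(σ₀)`, tail `≤ 2 ∑_{n > Q} n^{-σ₀}`).
[folklore] -/
theorem exists_forall_norm_LSeries_sub_le {σ₀ : ℝ} (hσ₀ : 1 < σ₀) {ε : ℝ} (hε : 0 < ε) :
    ∃ Q : ℕ, ∃ η : ℝ, 0 < η ∧ ∀ b₁ b₂ : ℕ → ℂ, (∀ n, ‖b₁ n‖ ≤ 1) → (∀ n, ‖b₂ n‖ ≤ 1) →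
      (∀ n, n ≠ 0 → n ≤ Q → ‖b₁ n - b₂ n‖ ≤ n * η) →
      ∀ s : ℂ, σ₀ ≤ s.re → ‖LSeries b₁ s - LSeries b₂ s‖ ≤ ε := by
  -- the majorant `w n = n^{-σ₀}` and its tails
  set w : ℕ → ℝ := fun n ↦ (n : ℝ) ^ (-σ₀) with hw
  have hw0 : ∀ n, 0 ≤ w n := fun n ↦ Real.rpow_nonneg n.cast_nonneg _
  have hwsum : Summable w := Real.summable_nat_rpow.2 (by linarith)
  have hC0 : 0 ≤ ∑' n, w n := tsum_nonneg hw0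
  obtain ⟨Q, hQ⟩ := (Metric.tendsto_atTop.1 (tendsto_sum_nat_add w)) (ε / 4) (by positivity)
  have htail : ∑' k, w (k + Q) < ε / 4 := by
    have := hQ Q le_rfl
    rwa [Real.dist_eq, sub_zero, abs_of_nonneg (tsum_nonneg fun k ↦ hw0 _)] at this
  have hQC : 0 < (Q : ℝ) * (∑' n, w n) + 1 := by positivity
  have hη0 : 0 < ε / (2 * ((Q : ℝ) * (∑' n, w n) + 1)) := by positivity
  refine ⟨Q, ε / (2 * ((Q : ℝ) * (∑' n, w n) + 1)), hη0, fun b₁ b₂ hb₁ hb₂ hclose s hs ↦ ?_⟩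
  set η : ℝ := ε / (2 * ((Q : ℝ) * (∑' n, w n) + 1)) with hη
  have hs1 : 1 < s.re := by linarith
  -- the difference coefficients
  set G : ℕ → ℂ := fun n ↦ b₁ n - b₂ n with hG
  have hG2 : ∀ n, ‖G n‖ ≤ 2 := fun n ↦
    (norm_sub_le _ _).trans (by linarith [hb₁ n, hb₂ n])
  have hsum₁ : LSeriesSummable b₁ s :=
    LSeriesSummable_of_bounded_of_one_lt_re (m := 1) (fun n _ ↦ hb₁ n) hs1
  have hsum₂ : LSeriesSummable b₂ s :=
    LSeriesSummable_of_bounded_of_one_lt_re (m := 1) (fun n _ ↦ hb₂ n) hs1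
  have hGsum : LSeriesSummable G s :=
    LSeriesSummable_of_bounded_of_one_lt_re (m := 2) (fun n _ ↦ hG2 n) hs1
  have hdiff : LSeries b₁ s - LSeries b₂ s = LSeries G s := (LSeries_sub hsum₁ hsum₂).symm
  -- termwise majorant
  set B : ℕ → ℝ := fun n ↦ Q * η * w n + 2 * (if Q ≤ n then w n else 0) with hB
  have hind0 : ∀ n, 0 ≤ (if Q ≤ n then w n else 0) := by
    intro n; split_ifs; exacts [hw0 n, le_rfl]
  have hterm : ∀ n, ‖term G s n‖ ≤ B n := by
    intro n
    have hB0 : 0 ≤ B n :=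
      add_nonneg (mul_nonneg (mul_nonneg (Nat.cast_nonneg Q) hη0.le) (hw0 n))
        (mul_nonneg zero_le_two (hind0 n))
    rcases eq_or_ne n 0 with rfl | hn
    · simpa using hB0
    have h1 : ‖term G s n‖ ≤ ‖G n‖ * w n := by
      refine (norm_term_le_of_re_le_re G (show ((σ₀ : ℝ) : ℂ).re ≤ s.re by simpa using hs)
        n).trans (le_of_eq ?_)
      rw [norm_term_eq, if_neg hn, ofReal_re]
      simp only [hw, Real.rpow_neg n.cast_nonneg, div_eq_mul_inv]
    refine h1.trans ?_
    by_cases hnQ : n ≤ Q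
    · have h2 : ‖G n‖ ≤ Q * η :=
        (hclose n hn hnQ).trans (mul_le_mul_of_nonneg_right (by exact_mod_cast hnQ) hη0.le)
      have h3 := mul_le_mul_of_nonneg_right h2 (hw0 n)
      have h4 : 0 ≤ 2 * (if Q ≤ n then w n else 0) := mul_nonneg zero_le_two (hind0 n)
      simp only [hB]
      linarith
    · have hle : Q ≤ n := by omega
      have h3 := mul_le_mul_of_nonneg_right (hG2 n) (hw0 n)
      have h4 : 0 ≤ (Q : ℝ) * η * w n := mul_nonneg (mul_nonneg (Nat.cast_nonneg Q) hη0.le) (hw0 n)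
      simp only [hB, if_pos hle]
      linarith
  -- summing the majorant
  have hind : Summable fun n ↦ (if Q ≤ n then w n else 0) := by
    refine hwsum.of_nonneg_of_le hind0 fun n ↦ ?_
    split_ifs; exacts [le_rfl, hw0 n]
  have hBsum : Summable B := (hwsum.mul_left _).add (hind.mul_left 2)
  have hind_eq : ∑' n, (if Q ≤ n then w n else 0) = ∑' k, w (k + Q) := by
    rw [← hind.sum_add_tsum_nat_add Q]
    have h0 : ∑ n ∈ Finset.range Q, (if Q ≤ n then w n else 0) = 0 :=
      Finset.sum_eq_zero fun n hn ↦ if_neg (by simp only [Finset.mem_range] at hn; omega)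
    rw [h0, zero_add]
    exact tsum_congr fun k ↦ if_pos (Nat.le_add_left Q k)
  have hBtsum : ∑' n, B n = Q * η * (∑' n, w n) + 2 * ∑' k, w (k + Q) := by
    simp only [hB]
    rw [(hwsum.mul_left _).tsum_add (hind.mul_left 2), tsum_mul_left, tsum_mul_left, hind_eq]
  have hmain : Q * η * (∑' n, w n) ≤ ε / 2 := by
    have h' : (Q : ℝ) * (∑' n, w n) / ((Q : ℝ) * (∑' n, w n) + 1) ≤ 1 :=
      (div_le_one hQC).2 (by linarith)
    have heq : (Q : ℝ) * η * (∑' n, w n) =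
        ε / 2 * ((Q : ℝ) * (∑' n, w n) / ((Q : ℝ) * (∑' n, w n) + 1)) := by
      rw [hη]; field_simp
    rw [heq]
    calc ε / 2 * ((Q : ℝ) * (∑' n, w n) / ((Q : ℝ) * (∑' n, w n) + 1)) ≤ ε / 2 * 1 :=
          mul_le_mul_of_nonneg_left h' (by positivity)
      _ = ε / 2 := mul_one _
  calc ‖LSeries b₁ s - LSeries b₂ s‖ = ‖∑' n, term G s n‖ := by rw [hdiff, LSeries]
    _ ≤ ∑' n, ‖term G s n‖ := norm_tsum_le_tsum_norm hGsum.norm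
    _ ≤ ∑' n, B n := hGsum.norm.tsum_le_tsum hterm hBsum
    _ = Q * η * (∑' n, w n) + 2 * ∑' k, w (k + Q) := hBtsum
    _ ≤ ε / 2 + 2 * (ε / 4) := by linarith [htail.le]
    _ = ε := by ring

/-- A uniform bound for the twisted `L`-series on `Re s ≥ σ₀ > 1`: `|∑ χ(n)ẽ(n)n^{-s}| ≤ ∑ n^{-σ₀}`.
[folklore] -/
theorem norm_LSeries_le_tsum_rpow {b : ℕ → ℂ} (hb : ∀ n, ‖b n‖ ≤ 1) {σ₀ : ℝ} (hσ₀ : 1 < σ₀)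
    {s : ℂ} (hs : σ₀ ≤ s.re) : ‖LSeries b s‖ ≤ ∑' n : ℕ, (n : ℝ) ^ (-σ₀) := by
  have hs1 : 1 < s.re := by linarith
  have hsum : LSeriesSummable b s :=
    LSeriesSummable_of_bounded_of_one_lt_re (m := 1) (fun n _ ↦ hb n) hs1
  have hwsum : Summable fun n : ℕ ↦ (n : ℝ) ^ (-σ₀) := Real.summable_nat_rpow.2 (by linarith)
  refine (norm_tsum_le_tsum_norm hsum.norm).trans (hsum.norm.tsum_le_tsum (fun n ↦ ?_) hwsum)
  rcases eq_or_ne n 0 with rfl | hn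
  · simp only [term_zero, norm_zero]
    positivity
  refine (norm_term_le_of_re_le_re b (show ((σ₀ : ℝ) : ℂ).re ≤ s.re by simpa using hs) n).trans
    ?_
  rw [norm_term_eq, if_neg hn, ofReal_re, Real.rpow_neg n.cast_nonneg, div_eq_mul_inv]
  exact mul_le_of_le_one_left (by positivity) (hb n)

/-- **Uniform comparison of two twists** (the two `γ/3n`-estimates of [SaiasWeingartner2009],
§4, p. 8, coefficientwise): for `σ₀ > 1` and `ε > 0` there are `Q` and `η > 0` such that for all
unit twists `e₁, e₂` with `|e₁(p) − e₂(p)| < η` at the primes `p ≤ Q`,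
`|F^{e₁}(s) − F^{e₂}(s)| ≤ ε` for every `s` with `Re s ≥ σ₀`. [cite: SaiasWeingartner2009, §4] -/
theorem exists_forall_norm_twistedComb_sub_le {ι : Type*} [Fintype ι] {q : ι → ℕ}
    (χ : ∀ i, DirichletCharacter ℂ (q i)) {P : ι → ℕ → ℂ}
    (hP : ∀ i, (Function.support (P i)).Finite) {σ₀ : ℝ} (hσ₀ : 1 < σ₀) {ε : ℝ} (hε : 0 < ε) :
    ∃ Q : ℕ, ∃ η : ℝ, 0 < η ∧ ∀ e₁ e₂ : ℕ → ℂ, (∀ p, p.Prime → ‖e₁ p‖ = 1) →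
      (∀ p, p.Prime → ‖e₂ p‖ = 1) → (∀ p : ℕ, p.Prime → p ≤ Q → ‖e₁ p - e₂ p‖ < η) →
      ∀ s : ℂ, σ₀ ≤ s.re → ‖twistedComb χ P e₁ s - twistedComb χ P e₂ s‖ ≤ ε := by
  classical
  -- constants
  set n : ℕ := Fintype.card ι with hn
  set T : ι → Finset ℕ := fun i ↦ (hP i).toFinset with hT
  set A : ℝ := ∑ i, ∑ k ∈ T i, ‖P i k‖ with hA
  set B : ℝ := ∑ i, ∑ k ∈ T i with k ≠ 0, ‖P i k‖ * k with hB
  set Z : ℝ := ∑' m : ℕ, (m : ℝ) ^ (-σ₀) with hZ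
  have hA0 : 0 ≤ A := Finset.sum_nonneg fun i _ ↦ Finset.sum_nonneg fun k _ ↦ norm_nonneg _
  have hB0 : 0 ≤ B := Finset.sum_nonneg fun i _ ↦ Finset.sum_nonneg fun k _ ↦ by positivity
  have hZ0 : 0 ≤ Z := tsum_nonneg fun m ↦ Real.rpow_nonneg m.cast_nonneg _
  -- the `L`-part
  obtain ⟨Q₁, η₁, hη₁, hL⟩ := exists_forall_norm_LSeries_sub_le hσ₀
    (ε := ε / (2 * (n + 1) * (A + 1))) (by positivity)
  -- the final `Q` and `η`
  set Q : ℕ := max Q₁ (Finset.univ.sup fun i ↦ (T i).sup id) with hQ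
  have hTQ : ∀ i, ∀ k ∈ T i, k ≤ Q := fun i k hk ↦
    le_max_of_le_right ((Finset.le_sup (f := id) hk).trans
      (Finset.le_sup (f := fun i ↦ (T i).sup id) (Finset.mem_univ i)))
  set η : ℝ := min η₁ (ε / (2 * (n + 1) * (B + 1) * (Z + 1))) with hηdef
  have hη0 : 0 < η := lt_min hη₁ (by positivity)
  refine ⟨Q, η, hη0, fun e₁ e₂ he₁ he₂ hclose s hs ↦ ?_⟩
  have he₁' : ∀ p, p.Prime → ‖e₁ p‖ ≤ 1 := fun p hp ↦ (he₁ p hp).le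
  have he₂' : ∀ p, p.Prime → ‖e₂ p‖ ≤ 1 := fun p hp ↦ (he₂ p hp).le
  have hs0 : 0 ≤ s.re := by linarith
  -- `|ẽ₁(m) − ẽ₂(m)| ≤ m η` for `m ≤ Q`
  have hmul := norm_complMul_sub_complMul_le he₁' he₂' hη0.le
    (fun p hp hpQ ↦ (hclose p hp hpQ).le)
  -- per-index bounds
  have hDsub : ∀ i, ‖LSeries (fun m ↦ P i m * complMul e₁ m) s -
      LSeries (fun m ↦ P i m * complMul e₂ m) s‖ ≤ B * η := by
    intro i
    refine (FiniteLSeries.norm_twist_sub_le (hP i) hs0 _ _).trans ?_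
    calc ∑ k ∈ T i with k ≠ 0, ‖P i k‖ * ‖complMul e₁ k - complMul e₂ k‖
        ≤ ∑ k ∈ T i with k ≠ 0, ‖P i k‖ * (k * η) := Finset.sum_le_sum fun k hk ↦ by
          obtain ⟨hkT, hk0⟩ := Finset.mem_filter.1 hk
          exact mul_le_mul_of_nonneg_left (hmul k hk0 (hTQ i k hkT)) (norm_nonneg _)
      _ = (∑ k ∈ T i with k ≠ 0, ‖P i k‖ * k) * η := by
          rw [Finset.sum_mul]; exact Finset.sum_congr rfl fun k _ ↦ by ring
      _ ≤ B * η := mul_le_mul_of_nonneg_right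
          (Finset.single_le_sum (f := fun i ↦ ∑ k ∈ T i with k ≠ 0, ‖P i k‖ * k)
            (fun i _ ↦ Finset.sum_nonneg fun k _ ↦ by positivity) (Finset.mem_univ i)) hη0.le
  have hDle : ∀ i (e : ℕ → ℂ), (∀ p, p.Prime → ‖e p‖ ≤ 1) →
      ‖LSeries (fun m ↦ P i m * complMul e m) s‖ ≤ A := by
    intro i e he
    have h1 := FiniteLSeries.norm_le (support_mul_finite (hP i) (complMul e)) hs0
    refine h1.trans ((Finset.sum_le_sum_of_subset_of_nonneg ?_ fun _ _ _ ↦ norm_nonneg _).trans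
      ((Finset.sum_le_sum fun k _ ↦ ?_).trans (Finset.single_le_sum
        (f := fun i ↦ ∑ k ∈ T i, ‖P i k‖) (fun i _ ↦ Finset.sum_nonneg fun k _ ↦ norm_nonneg _)
        (Finset.mem_univ i))))
    · intro k hk
      have := (support_mul_finite (hP i) (complMul e)).mem_toFinset.1 hk
      exact (hP i).mem_toFinset.2 (Function.mem_support.2 (left_ne_zero_of_mul this))
    · rw [norm_mul]
      exact mul_le_of_le_one_right (norm_nonneg _) (norm_complMul_le_one he k)
  have hLsub : ∀ i, ‖LSeries (fun m ↦ χ i m * complMul e₁ m) s -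
      LSeries (fun m ↦ χ i m * complMul e₂ m) s‖ ≤ ε / (2 * (n + 1) * (A + 1)) := by
    intro i
    refine hL _ _ (norm_char_mul_complMul_le_one (χ i) he₁')
      (norm_char_mul_complMul_le_one (χ i) he₂') (fun m hm hmQ ↦ ?_) s hs
    rw [← mul_sub, norm_mul]
    calc ‖(χ i) m‖ * ‖complMul e₁ m - complMul e₂ m‖ ≤ 1 * (m * η) :=
          mul_le_mul ((χ i).norm_le_one m) (hmul m hm (hmQ.trans (le_max_left _ _)))
            (norm_nonneg _) zero_le_one
      _ ≤ m * η₁ := by rw [one_mul]; exact mul_le_mul_of_nonneg_left (min_le_left _ _) m.cast_nonneg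
  have hLle : ∀ i, ‖LSeries (fun m ↦ χ i m * complMul e₁ m) s‖ ≤ Z := fun i ↦
    norm_LSeries_le_tsum_rpow (norm_char_mul_complMul_le_one (χ i) he₁') hσ₀ hs
  -- assembling
  rw [twistedComb_apply, twistedComb_apply, ← Finset.sum_sub_distrib]
  calc ‖∑ i, (LSeries (fun m ↦ P i m * complMul e₁ m) s *
          LSeries (fun m ↦ χ i m * complMul e₁ m) s -
        LSeries (fun m ↦ P i m * complMul e₂ m) s * LSeries (fun m ↦ χ i m * complMul e₂ m) s)‖
      ≤ ∑ i, ‖LSeries (fun m ↦ P i m * complMul e₁ m) s *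
          LSeries (fun m ↦ χ i m * complMul e₁ m) s -
        LSeries (fun m ↦ P i m * complMul e₂ m) s * LSeries (fun m ↦ χ i m * complMul e₂ m) s‖ :=
        norm_sum_le _ _
    _ ≤ ∑ _i : ι, (B * η * Z + A * (ε / (2 * (n + 1) * (A + 1)))) := by
        refine Finset.sum_le_sum fun i _ ↦ ?_
        have key : ∀ (D₁ D₂ L₁ L₂ : ℂ), D₁ * L₁ - D₂ * L₂ = (D₁ - D₂) * L₁ + D₂ * (L₁ - L₂) := by
          intros; ring
        rw [key]
        refine (norm_add_le _ _).trans ?_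
        rw [norm_mul, norm_mul]
        exact add_le_add (mul_le_mul (hDsub i) (hLle i) (norm_nonneg _) (by positivity))
          (mul_le_mul (hDle i e₂ he₂') (hLsub i) (norm_nonneg _) hA0)
    _ = n * (B * η * Z + A * (ε / (2 * (n + 1) * (A + 1)))) := by
        rw [Finset.sum_const, Finset.card_univ, nsmul_eq_mul]
    _ ≤ ε / 2 + ε / 2 := by
        have h1 : (n : ℝ) * (B * η * Z) ≤ ε / 2 := by
          have hηle : η ≤ ε / (2 * (n + 1) * (B + 1) * (Z + 1)) := min_le_right _ _
          calc (n : ℝ) * (B * η * Z) ≤ (n + 1) * ((B + 1) * η * (Z + 1)) := by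
                have h1 : B * η * Z ≤ (B + 1) * η * (Z + 1) := by nlinarith [hη0.le, hB0, hZ0]
                have h2 : 0 ≤ (B + 1) * η * (Z + 1) := by positivity
                have h3 : (n : ℝ) * (B * η * Z) ≤ n * ((B + 1) * η * (Z + 1)) :=
                  mul_le_mul_of_nonneg_left h1 (Nat.cast_nonneg n)
                nlinarith [h2, h3]
            _ ≤ (n + 1) * ((B + 1) * (ε / (2 * (n + 1) * (B + 1) * (Z + 1))) * (Z + 1)) := by
                gcongr
            _ = ε / 2 := by field_simp
        have h2 : (n : ℝ) * (A * (ε / (2 * (n + 1) * (A + 1)))) ≤ ε / 2 := by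
          calc (n : ℝ) * (A * (ε / (2 * (n + 1) * (A + 1))))
              ≤ (n + 1) * ((A + 1) * (ε / (2 * (n + 1) * (A + 1)))) := by
                gcongr <;> linarith
            _ = ε / 2 := by field_simp
        rw [mul_add]
        exact add_le_add h1 h2
    _ = ε := by ring

end Literature.NumberTheory.LFunctions
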